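import Summits.CriticalPhenomena.SAWScalingLimit.Theorems.SAWDevelopingMapHexTransferThirdBdryEndpointsGeometry
import Summits.CriticalPhenomena.SAWScalingLimit.Theorems.SAWDevelopingMapHexTransferThirdBdryEndpointsFaceChains

/-!
# `ThirdBdryEndpoints` (line `yb-relay`, crux `HexTransfer`, stmt-CriticalPhenomena-14221)

Stub `stub_thirdBdryEndpoints` of the line `yb-relay` for the crux
`Summit.CriticalPhenomena.SAWScalingLimit.Theses.SAWDevelopingMap.HexTransfer`
(stmt-CriticalPhenomena-14221; identical copies in `SAWPhaseRetrieval`, `SAWDefectDecoherence`,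
`SAWWindingAlias`): **every Dobrushin domain `D = (Ω; a, b)` admits mid-edge endpoint
approximations on Glazman–Manolescu's hexagonal point `Θ ≡ π/3` THROUGH BOUNDARY EDGES of
`Ω_δ = meshFaces (π/3) Ω δ`** — for all small `δ > 0` exactly one of the two faces of `a_δ`
(resp. `b_δ`) lies in `Ω_δ`, a Yang–Baxter walk of `Ω_δ` joins `a_δ` to `b_δ`, and `δ a_δ → a`,
`δ b_δ → b` (`IsYBEndpointApprox`) — the form needed by the exact `π/3` dictionary with the
hexagonal-lattice SAW (walks of a face domain start and stop at boundary mid-edges). Proved for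
every constant angle `θ ∈ [π/3, 2π/3]` (`ybBdryEndpoints_of_mem_Icc`); without the boundary
clause this is verbatim conjunct (i) of route SAWTrackTransport's `YBLimitExists`
(stmt-CriticalPhenomena-16995), `ybEndpoints_of_mem_Icc`.

Proof (template: the `π/2` construction `Sketch.stub_compassEndpoints`; constant-angle geometry
in `…ThirdBdryEndpointsGeometry`, walks between prescribed sides in
`…ThirdBdryEndpointsFaceChains`). Interior points `z_n → a`, `w_n → b`; at stage `n`, for `δ`
below a threshold, the faces of `z_n/δ`, `w_n/δ` lie in `Ω_δ` and are joined in the adjacency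
graph of `Ω_δ` (bulk lemma). NEW PART (`exists_bdrySide_near`): in their (finite) component `C`
take a face `g_a` minimising the skew `ℓ¹` distance `Φ_a(k, j) = |A - k - 1/2| + |B - j - 1/2|`
to `a/δ = A v + (B - 1/2) i` (`v = sin θ - i cos θ`), likewise `g_b`. KEY CLAIM
(`exists_side_of_pot_le`): some side of `g_a` borders no other face of `Ω_δ` — otherwise the
four neighbours of `g_a = (k, j)` lie in `Ω_δ`, hence in `C`, and `Φ_a(g_a) ≤ Φ_a(k ± 1, j),
Φ_a(k, j ± 1)` force `|A - k - 1/2|, |B - j - 1/2| ≤ 1/2`, i.e. `a/δ` lies in the closed rhombus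
of `g_a ∈ Ω_δ`, so `a ∈ Ω` — but `a ∈ ∂Ω`, `Ω` open. That side `e_a` is a boundary edge of `Ω_δ`
within `δ (Φ_a(g_a) + 3) ≤ δ (Φ_a(face of z_n/δ) + 3) ≤ 4 |a - z_n| + 4δ` of `a`; `e_a, e_b` are
joined by a Yang–Baxter walk of `Ω_δ` (`nonempty_ybWalk_of_reachable`); diagonal stage selection.
-/

noncomputable section

open MeasureTheory Filter Topology Set Metric
open Complex (I)
open Literature.Probability.RandomPlanarGeometry
open Literature.Probability.RandomPlanarGeometry.SAW.YangBaxter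
open Summit.CriticalPhenomena.SAWScalingLimit.Theses

namespace Summit.CriticalPhenomena.SAWScalingLimit.Cruxes.HexTransfer.YbRelay

namespace ThirdEndpoints

variable {θ : ℝ}

/-! ### The face of a component closest to a boundary point has an excluded neighbour -/

/-- `|t| ≤ |t - 1|` forces `t ≤ 1/2`. [folklore] -/
theorem le_half_of_abs_le_abs_sub_one {t : ℝ} (h : |t| ≤ |t - 1|) : t ≤ 1 / 2 := by
  rcases abs_cases t with ⟨h1, _⟩ | ⟨h1, _⟩ <;>
    rcases abs_cases (t - 1) with ⟨h2, _⟩ | ⟨h2, _⟩ <;> linarith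

/-- `|t| ≤ |t + 1|` forces `-1/2 ≤ t`. [folklore] -/
theorem neg_half_le_of_abs_le_abs_add_one {t : ℝ} (h : |t| ≤ |t + 1|) : -(1 / 2) ≤ t := by
  rcases abs_cases t with ⟨h1, _⟩ | ⟨h1, _⟩ <;>
    rcases abs_cases (t + 1) with ⟨h2, _⟩ | ⟨h2, _⟩ <;> linarith

/-- **Key claim.** Let `u = A v + (B - 1/2) i` (skew coordinates `A, B`) with `δ u ∉ Ω`. If the
potential `|A - k - 1/2| + |B - j - 1/2|` of `g = (k, j) ∈ Ω_δ` (skew `ℓ¹` distance from `u` to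
the centre of `g`) does not exceed that of the faces of `Ω_δ` sharing a side with `g`, then some
side of `g` borders no other face of `Ω_δ`: otherwise all four neighbours lie in `Ω_δ`, the four
inequalities give `|A - k - 1/2|, |B - j - 1/2| ≤ 1/2`, so `u` lies in the closed rhombus of
`g ∈ Ω_δ` and `δ u ∈ Ω`. [folklore] -/
theorem exists_side_of_pot_le {Ω : Set ℂ} {δ : ℝ} (A B : ℝ)
    (hout : (δ : ℂ) * ((A : ℂ) * ((Real.sin θ : ℂ) - (Real.cos θ : ℂ) * I) + ((B : ℂ) - 1 / 2) * I)
      ∉ Ω) {g : Face} (hg : g ∈ meshFaces (fun (_ : ℤ) => θ) Ω δ)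
    (hmin : ∀ g' ∈ meshFaces (fun (_ : ℤ) => θ) Ω δ,
      (∃ e : MidEdge, (∃ s, g.side s = e) ∧ ∃ t, g'.side t = e) →
      |A - g.1 - 1 / 2| + |B - g.2 - 1 / 2| ≤ |A - g'.1 - 1 / 2| + |B - g'.2 - 1 / 2|) :
    ∃ e : MidEdge, (∃ s, g.side s = e) ∧
      ∀ x : Face, (∃ s, x.side s = e) → x ∈ meshFaces (fun (_ : ℤ) => θ) Ω δ → x = g := by
  obtain ⟨k, j⟩ := g
  by_contra H
  push Not at H
  have nbr : ∀ (s : Side) (x' : Face), x' ≠ (k, j) →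
      (∀ x : Face, (∃ t, x.side t = Face.side (k, j) s) → x = x' ∨ x = (k, j)) →
      x' ∈ meshFaces (fun (_ : ℤ) => θ) Ω δ := by
    intro s x' _ hx'
    obtain ⟨x, hx, hxm, hxne⟩ := H _ ⟨s, rfl⟩
    rcases hx' x hx with rfl | rfl
    · exact hxm
    · exact absurd rfl hxne
  have hE : ((k + 1, j) : Face) ∈ meshFaces (fun (_ : ℤ) => θ) Ω δ := by
    refine nbr .E _ (by simp) fun x hx => ?_
    rw [Face.exists_side_eq_iff] at hx
    simpa [Face.side, MidEdge.faces, or_comm] using hx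
  have hW : ((k - 1, j) : Face) ∈ meshFaces (fun (_ : ℤ) => θ) Ω δ := by
    refine nbr .W _ (by simp) fun x hx => ?_
    rw [Face.exists_side_eq_iff] at hx
    simpa [Face.side, MidEdge.faces] using hx
  have hN : ((k, j + 1) : Face) ∈ meshFaces (fun (_ : ℤ) => θ) Ω δ := by
    refine nbr .N _ (by simp) fun x hx => ?_
    rw [Face.exists_side_eq_iff] at hx
    simpa [Face.side, MidEdge.faces, or_comm] using hx
  have hS : ((k, j - 1) : Face) ∈ meshFaces (fun (_ : ℤ) => θ) Ω δ := by
    refine nbr .S _ (by simp) fun x hx => ?_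
    rw [Face.exists_side_eq_iff] at hx
    simpa [Face.side, MidEdge.faces] using hx
  have iE := hmin _ hE ⟨_, ⟨.E, rfl⟩, ⟨.W, rfl⟩⟩
  have iW := hmin _ hW ⟨_, ⟨.W, rfl⟩, ⟨.E, by simp [Face.side]⟩⟩
  have iN := hmin _ hN ⟨_, ⟨.N, rfl⟩, ⟨.S, rfl⟩⟩
  have iS := hmin _ hS ⟨_, ⟨.S, rfl⟩, ⟨.N, by simp [Face.side]⟩⟩
  dsimp only at iE iW iN iS
  push_cast at iE iW iN iS
  have ht1 : A - k - 1 / 2 ≤ 1 / 2 := by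
    apply le_half_of_abs_le_abs_sub_one
    rw [show A - k - 1 / 2 - 1 = A - (k + 1) - 1 / 2 by ring]
    linarith
  have ht2 : -(1 / 2) ≤ A - k - 1 / 2 := by
    apply neg_half_le_of_abs_le_abs_add_one
    rw [show A - k - 1 / 2 + 1 = A - (k - 1) - 1 / 2 by ring]
    linarith
  have hu1 : B - j - 1 / 2 ≤ 1 / 2 := by
    apply le_half_of_abs_le_abs_sub_one
    rw [show B - j - 1 / 2 - 1 = B - (j + 1) - 1 / 2 by ring]
    linarith
  have hu2 : -(1 / 2) ≤ B - j - 1 / 2 := by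
    apply neg_half_le_of_abs_le_abs_add_one
    rw [show B - j - 1 / 2 + 1 = B - (j - 1) - 1 / 2 by ring]
    linarith
  refine hout (hg _ ?_)
  rw [show (A : ℂ) * ((Real.sin θ : ℂ) - (Real.cos θ : ℂ) * I) + ((B : ℂ) - 1 / 2) * I =
      planeCorner (fun (_ : ℤ) => θ) (k, j) +
        ((A - k : ℝ) : ℂ) * ((Real.sin θ : ℂ) - (Real.cos θ : ℂ) * I) + ((B - j : ℝ) : ℂ) * I by
    rw [planeCorner_const]; push_cast; ring]
  exact corner_add_mem_rhombus θ (k, j) ⟨by linarith, by linarith⟩ ⟨by linarith, by linarith⟩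

/-- The two faces bordering a mid-edge are distinct. [folklore] -/
theorem faces_fst_ne_snd (e : MidEdge) : e.faces.1 ≠ e.faces.2 := by
  cases e <;> simp [MidEdge.faces]

/-- A side of a face `g ∈ S` bordering no other face of `S` is a **boundary edge** of `S`:
exactly one of its two faces lies in `S`. [folklore] -/
theorem isBdry_of_unique {S : Set Face} {g : Face} {e : MidEdge} (he : ∃ s, g.side s = e)
    (hg : g ∈ S) (hu : ∀ x : Face, (∃ s, x.side s = e) → x ∈ S → x = g) :
    (e.faces.1 ∈ S ∧ e.faces.2 ∉ S) ∨ (e.faces.1 ∉ S ∧ e.faces.2 ∈ S) := by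
  have h1 : ∃ s, e.faces.1.side s = e := (Face.exists_side_eq_iff _ _).2 (Or.inl rfl)
  have h2 : ∃ s, e.faces.2.side s = e := (Face.exists_side_eq_iff _ _).2 (Or.inr rfl)
  rcases (Face.exists_side_eq_iff _ _).1 he with hge | hge
  · exact Or.inl ⟨hge ▸ hg, fun h => faces_fst_ne_snd e ((hu _ h2 h).trans hge).symm⟩
  · exact Or.inr ⟨fun h => faces_fst_ne_snd e ((hu _ h1 h).trans hge), hge ▸ hg⟩

/-- The midpoint of a side of `g` is within `Φ + 3` of the point `u = A v + (B - 1/2) i` (skew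
distance `Φ` from `u` to the centre of `g`, plus `1` to the corner, plus the diameter `2`).
[folklore] -/
theorem dist_planeMidpoint_le_pot (A B : ℝ) {g : Face} {e : MidEdge} (he : ∃ s, g.side s = e) :
    dist (planeMidpoint (fun (_ : ℤ) => θ) e)
      ((A : ℂ) * ((Real.sin θ : ℂ) - (Real.cos θ : ℂ) * I) + ((B : ℂ) - 1 / 2) * I) ≤
      |A - g.1 - 1 / 2| + |B - g.2 - 1 / 2| + 3 := by
  obtain ⟨s, rfl⟩ := he
  have h1 : dist (planeMidpoint (fun (_ : ℤ) => θ) (g.side s)) (planeCorner (fun (_ : ℤ) => θ) g)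
      ≤ 2 :=
    rhombus_const_subset_closedBall θ g (planeMidpoint_side_mem_rhombus _ g s)
  have h2 : dist (planeCorner (fun (_ : ℤ) => θ) g)
      ((A : ℂ) * ((Real.sin θ : ℂ) - (Real.cos θ : ℂ) * I) + ((B : ℂ) - 1 / 2) * I) ≤
      |A - g.1 - 1 / 2| + |B - g.2 - 1 / 2| + 1 := by
    obtain ⟨k, j⟩ := g
    rw [dist_comm, dist_eq_norm,
      show (A : ℂ) * ((Real.sin θ : ℂ) - (Real.cos θ : ℂ) * I) + ((B : ℂ) - 1 / 2) * I -
        planeCorner (fun (_ : ℤ) => θ) (k, j) =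
        ((A - k : ℝ) : ℂ) * ((Real.sin θ : ℂ) - (Real.cos θ : ℂ) * I) + ((B - j : ℝ) : ℂ) * I by
      rw [planeCorner_const]; push_cast; ring]
    refine (norm_skew_le θ _ _).trans ?_
    dsimp only
    have i1 := abs_add_le (A - k - 1 / 2) (1 / 2)
    have i2 := abs_add_le (B - j - 1 / 2) (1 / 2)
    rw [show A - k - 1 / 2 + 1 / 2 = A - k by ring] at i1
    rw [show B - j - 1 / 2 + 1 / 2 = B - j by ring] at i2
    rw [abs_of_pos (show (0 : ℝ) < 1 / 2 by norm_num)] at i1 i2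
    linarith
  linarith [dist_triangle (planeMidpoint (fun (_ : ℤ) => θ) (g.side s))
    (planeCorner (fun (_ : ℤ) => θ) g)
    ((A : ℂ) * ((Real.sin θ : ℂ) - (Real.cos θ : ℂ) * I) + ((B : ℂ) - 1 / 2) * I)]

/-- The potential of the face `(⌊A'⌋, ⌊B'⌋)` seen from `(A, B)` is at most `4 d + 1` when
`|A - A'|, |B - B'| ≤ 2 d`. [folklore] -/
theorem pot_floor_le {A A' B B' d : ℝ} (hA : |A - A'| ≤ 2 * d) (hB : |B - B'| ≤ 2 * d) :
    |A - ⌊A'⌋ - 1 / 2| + |B - ⌊B'⌋ - 1 / 2| ≤ 4 * d + 1 := by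
  have h1 : |A' - (⌊A'⌋ + 1 / 2)| ≤ 1 / 2 := by
    rw [abs_le]
    constructor <;> linarith [Int.floor_le A', Int.lt_floor_add_one A']
  have h2 : |B' - (⌊B'⌋ + 1 / 2)| ≤ 1 / 2 := by
    rw [abs_le]
    constructor <;> linarith [Int.floor_le B', Int.lt_floor_add_one B']
  rw [sub_sub, sub_sub]
  linarith [abs_sub_le A A' (⌊A'⌋ + 1 / 2), abs_sub_le B B' (⌊B'⌋ + 1 / 2)]

/-! ### A boundary side near a boundary point; the stage threshold -/

/-- Rescaling distances: `dist (p/δ) (z/δ) = dist z p / δ`. [folklore] -/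
theorem dist_div_div {δ : ℝ} (hδ : 0 < δ) (p z : ℂ) : dist (p / δ) (z / δ) = dist z p / δ := by
  rw [dist_comm, dist_eq_norm, ← sub_div, norm_div, Complex.norm_real, Real.norm_of_nonneg hδ.le,
    dist_eq_norm]

/-- **A boundary side of the component near a boundary point.** Let `Ω_δ` be finite, `r ∉ Ω`,
and let the face of `x/δ` lie in `Ω_δ` and be joined to `f₀` in `Ω_δ`. Then some face `g` of
`Ω_δ` joined to `f₀` has a side `e` bordering no other face of `Ω_δ`, with
`|δ e - r| ≤ 4 |x - r| + 4δ`: take `g` in the component minimising the skew distance to `r/δ`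
(`Set.exists_min_image`), apply the key claim, and bound the distance through the face of `x/δ`
(`pot_floor_le`, skew coordinates are `2`-Lipschitz). [folklore] -/
theorem exists_bdrySide_near (hs : 1 / 2 < Real.sin θ) (hc : |Real.cos θ| ≤ 1 / 2) {Ω : Set ℂ}
    {δ : ℝ} (hδ : 0 < δ) (hfin : (meshFaces (fun (_ : ℤ) => θ) Ω δ).Finite) {r x : ℂ}
    (hr : r ∉ Ω) {f₀ : Face}
    (hx : (SimpleGraph.fromRel fun f g : Face =>
      (∃ e : MidEdge, (∃ s, f.side s = e) ∧ ∃ t, g.side t = e) ∧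
        f ∈ meshFaces (fun (_ : ℤ) => θ) Ω δ ∧ g ∈ meshFaces (fun (_ : ℤ) => θ) Ω δ).Reachable f₀
      (⌊(x / δ).re / Real.sin θ⌋, ⌊(x / δ).im + (x / δ).re * Real.cos θ / Real.sin θ + 1 / 2⌋))
    (hxS : ((⌊(x / δ).re / Real.sin θ⌋,
      ⌊(x / δ).im + (x / δ).re * Real.cos θ / Real.sin θ + 1 / 2⌋) : Face) ∈
        meshFaces (fun (_ : ℤ) => θ) Ω δ) :
    ∃ (g : Face) (e : MidEdge), g ∈ meshFaces (fun (_ : ℤ) => θ) Ω δ ∧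
      (SimpleGraph.fromRel fun f g : Face =>
        (∃ e : MidEdge, (∃ s, f.side s = e) ∧ ∃ t, g.side t = e) ∧
          f ∈ meshFaces (fun (_ : ℤ) => θ) Ω δ ∧ g ∈ meshFaces (fun (_ : ℤ) => θ) Ω δ).Reachable
        f₀ g ∧
      (∃ s, g.side s = e) ∧
      (∀ y : Face, (∃ s, y.side s = e) → y ∈ meshFaces (fun (_ : ℤ) => θ) Ω δ → y = g) ∧
      dist ((δ : ℂ) * planeMidpoint (fun (_ : ℤ) => θ) e) r ≤ 4 * dist x r + 4 * δ := by
  have hs0 : Real.sin θ ≠ 0 := by positivity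
  set S := meshFaces (fun (_ : ℤ) => θ) Ω δ with hSdef
  set G := SimpleGraph.fromRel fun f g : Face =>
    (∃ e : MidEdge, (∃ s, f.side s = e) ∧ ∃ t, g.side t = e) ∧ f ∈ S ∧ g ∈ S with hGdef
  set A := (r / δ).re / Real.sin θ with hAdef
  set B := (r / δ).im + (r / δ).re * Real.cos θ / Real.sin θ + 1 / 2 with hBdef
  have hr' : r / δ = (A : ℂ) * ((Real.sin θ : ℂ) - (Real.cos θ : ℂ) * I) + ((B : ℂ) - 1 / 2) * I :=
    eq_skew hs0 (r / δ)
  set C : Set Face := {g | g ∈ S ∧ G.Reachable f₀ g} with hCdef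
  have hxC : ((⌊(x / δ).re / Real.sin θ⌋,
      ⌊(x / δ).im + (x / δ).re * Real.cos θ / Real.sin θ + 1 / 2⌋) : Face) ∈ C := ⟨hxS, hx⟩
  obtain ⟨g, hgC, hgmin⟩ := C.exists_min_image
    (fun g : Face => |A - g.1 - 1 / 2| + |B - g.2 - 1 / 2|) (hfin.subset fun g hg => hg.1) ⟨_, hxC⟩
  have hout : (δ : ℂ) * ((A : ℂ) * ((Real.sin θ : ℂ) - (Real.cos θ : ℂ) * I) +
      ((B : ℂ) - 1 / 2) * I) ∉ Ω := by
    rw [← hr', mul_div_cancel₀ _ (Complex.ofReal_ne_zero.2 hδ.ne')]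
    exact hr
  obtain ⟨e, he, hu⟩ := exists_side_of_pot_le A B hout hgC.1 (fun g' hg' hadj => by
    by_cases hne : g = g'
    · rw [hne]
    · exact hgmin g' ⟨hg', hgC.2.trans (SimpleGraph.Adj.reachable
        ((SimpleGraph.fromRel_adj _ _ _).2 ⟨hne, Or.inl ⟨hadj, hgC.1, hg'⟩⟩))⟩)
  refine ⟨g, e, hgC.1, hgC.2, he, hu, ?_⟩
  have h1 := dist_planeMidpoint_le_pot A B he (θ := θ)
  rw [← hr'] at h1
  have h2 := hgmin _ hxC
  dsimp only at h2
  have h3 := pot_floor_le (abs_skA_sub_le hs (r / δ) (x / δ)) (abs_skB_sub_le hs hc (r / δ) (x / δ))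
  rw [dist_div_div hδ] at h3
  rw [dist_eq_norm, Sketch.Endpoints.norm_mul_sub_eq hδ, ← dist_eq_norm]
  calc δ * dist (planeMidpoint (fun (_ : ℤ) => θ) e) (r / δ) ≤ δ * (4 * (dist x r / δ) + 4) := by
        gcongr
        linarith
    _ = 4 * dist x r + 4 * δ := by field_simp

/-- **Stage threshold.** Let `z, w ∈ Ω` (a Dobrushin domain) and `p, q ∉ Ω`. There is `ε > 0`
such that for every mesh `0 < δ < ε` there are boundary edges `a, b` of `Ω_δ`, joined by a
Yang–Baxter walk of `Ω_δ`, with `|δ a - p| ≤ 4 |z - p| + 4δ`, `|δ b - q| ≤ 4 |w - q| + 4δ` (the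
faces of `z/δ, w/δ` lie in `Ω_δ` and are joined there by the bulk lemma; `exists_bdrySide_near`,
`nonempty_ybWalk_of_reachable`). Stated as `∀ δ, ∃ a b, 0 < δ → δ < ε → …`. [folklore] -/
theorem exists_bdry_threshold (hθ : θ ∈ Icc (Real.pi / 3) (2 * Real.pi / 3)) (D : DobrushinDomain)
    {z w : ℂ} (hz : z ∈ D.carrier) (hw : w ∈ D.carrier) {p q : ℂ} (hp : p ∉ D.carrier)
    (hq : q ∉ D.carrier) :
    ∃ ε : ℝ, 0 < ε ∧ ∀ δ : ℝ, ∃ a b : MidEdge, 0 < δ → δ < ε →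
      ((a.faces.1 ∈ meshFaces (fun (_ : ℤ) => θ) D.carrier δ ∧
          a.faces.2 ∉ meshFaces (fun (_ : ℤ) => θ) D.carrier δ) ∨
        (a.faces.1 ∉ meshFaces (fun (_ : ℤ) => θ) D.carrier δ ∧
          a.faces.2 ∈ meshFaces (fun (_ : ℤ) => θ) D.carrier δ)) ∧
      ((b.faces.1 ∈ meshFaces (fun (_ : ℤ) => θ) D.carrier δ ∧
          b.faces.2 ∉ meshFaces (fun (_ : ℤ) => θ) D.carrier δ) ∨
        (b.faces.1 ∉ meshFaces (fun (_ : ℤ) => θ) D.carrier δ ∧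
          b.faces.2 ∈ meshFaces (fun (_ : ℤ) => θ) D.carrier δ)) ∧
      Nonempty (YangBaxterSAW (fun (_ : ℤ) => θ) D.carrier δ a b) ∧
      dist ((δ : ℂ) * planeMidpoint (fun (_ : ℤ) => θ) a) p ≤ 4 * dist z p + 4 * δ ∧
      dist ((δ : ℂ) * planeMidpoint (fun (_ : ℤ) => θ) b) q ≤ 4 * dist w q + 4 * δ := by
  have hs := half_lt_sin hθ
  have hc := abs_cos_le_half hθ
  have hs0 : Real.sin θ ≠ 0 := by positivity
  have hK : ({z, w} : Set ℂ) ⊆ D.carrier := by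
    intro x hx
    simp only [Set.mem_insert_iff, Set.mem_singleton_iff] at hx
    rcases hx with rfl | rfl
    exacts [hz, hw]
  obtain ⟨V, -, hVc, hKV, -, ρ, hρ, hVρ⟩ :=
    Literature.Probability.LatticeModels.exists_isOpen_isPreconnected_bulk D.isOpen D.isConnected
      (Set.nonempty_compl.2 D.toJordanDomain.carrier_ne_univ) (Set.toFinite {z, w}).isCompact hK
  have hVΩ : ∀ x ∈ V, ball x ρ ⊆ D.carrier := fun x hx =>
    (ball_subset_ball (hVρ x hx).le).trans ball_infDist_compl_subset
  have hzV : z ∈ V := hKV (by simp)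
  have hwV : w ∈ V := hKV (by simp)
  refine ⟨ρ / 5, by positivity, fun δ => ?_⟩
  by_cases hgood : 0 < δ ∧ δ < ρ / 5
  swap
  · exact ⟨.vert 0 0, .vert 0 0, fun h₁ h₂ => absurd ⟨h₁, h₂⟩ hgood⟩
  obtain ⟨hδ, hδε⟩ := hgood
  have hδρ : 5 * δ ≤ ρ := by linarith
  have hfin := meshFaces_const_finite hs hc D.isBounded hδ
  have hfz := mem_meshFaces_const_of_dist_lt hδ hδρ (hVΩ z hzV)
    ((dist_planeCorner_face_lt hs0 (z / δ)).trans (by norm_num))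
  have hfw := mem_meshFaces_const_of_dist_lt hδ hδρ (hVΩ w hwV)
    ((dist_planeCorner_face_lt hs0 (w / δ)).trans (by norm_num))
  have hreach := reachable_const_of_mem hs hc hVc hVΩ hδ hδρ hzV hwV
  obtain ⟨ga, ea, hgaS, hga, hea, hua, hda⟩ :=
    exists_bdrySide_near hs hc hδ hfin hp (SimpleGraph.Reachable.refl _) hfz
  obtain ⟨gb, eb, hgbS, hgb, heb, hub, hdb⟩ := exists_bdrySide_near hs hc hδ hfin hq hreach hfw
  exact ⟨ea, eb, fun _ _ => ⟨isBdry_of_unique hea hgaS hua, isBdry_of_unique heb hgbS hub,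
    nonempty_ybWalk_of_reachable _ ga gb (hga.symm.trans hgb) hgaS ea eb hea hua heb hub, hda, hdb⟩⟩

/-! ### Endpoints: the limit along the diagonal stage selection -/

/-- If, eventually along `δ → 0⁺`, `u δ` is within `4 |z (N δ) - p| + 4δ` of `p`, `z n → p` at
rate `1/(n+1)` and `N δ → ∞`, then `u δ → p`. [folklore] -/
theorem tendsto_of_eventually_dist_le {u : ℝ → ℂ} {z : ℕ → ℂ} {p : ℂ} {N : ℝ → ℕ}
    (hu : ∀ᶠ δ in 𝓝[>] (0 : ℝ), dist (u δ) p ≤ 4 * dist (z (N δ)) p + 4 * δ)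
    (hz : ∀ n, dist (z n) p < 1 / ((n : ℝ) + 1)) (hN : Tendsto N (𝓝[>] (0 : ℝ)) atTop) :
    Tendsto u (𝓝[>] (0 : ℝ)) (𝓝 p) := by
  rw [Metric.tendsto_nhds]
  intro ε hε
  obtain ⟨n₀, hn₀⟩ := exists_nat_one_div_lt (show 0 < ε / 8 by positivity)
  filter_upwards [hu, Ioo_mem_nhdsGT (show (0 : ℝ) < ε / 8 by positivity),
    hN.eventually (eventually_ge_atTop n₀)] with δ huδ hδ hNδ
  have h2 : dist (z (N δ)) p < ε / 8 := by
    refine (hz (N δ)).trans_le ((one_div_le_one_div_of_le (by positivity) ?_).trans hn₀.le)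
    have : (n₀ : ℝ) ≤ N δ := by exact_mod_cast hNδ
    linarith
  linarith [hδ.2]

/-- **Boundary endpoint approximations at a constant angle `θ ∈ [π/3, 2π/3]`**: every Dobrushin
domain `(Ω; a, b)` admits mid-edge endpoint approximations `a_δ, b_δ` on the constant-angle
tiling through BOUNDARY edges of `Ω_δ` (exactly one of the two faces of `a_δ`, resp. `b_δ`,
lies in `Ω_δ`), joined by a Yang–Baxter walk of `Ω_δ` for all small `δ`, with `δ a_δ → a`,
`δ b_δ → b`. Interior points `z_n → a`, `w_n → b`; stage thresholds `exists_bdry_threshold`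
(with `p = a`, `q = b ∉ Ω`, as `a, b ∈ ∂Ω` and `Ω` is open); diagonal stage selection
`exists_stage_tendsto_atTop`. [folklore] -/
theorem ybBdryEndpoints (hθ : θ ∈ Icc (Real.pi / 3) (2 * Real.pi / 3)) (D : DobrushinDomain) :
    ∃ a b : ℝ → MidEdge, IsYBEndpointApprox (fun (_ : ℤ) => θ) D a b ∧ ∀ᶠ δ in 𝓝[>] (0 : ℝ),
      (((a δ).faces.1 ∈ meshFaces (fun (_ : ℤ) => θ) D.carrier δ ∧
          (a δ).faces.2 ∉ meshFaces (fun (_ : ℤ) => θ) D.carrier δ) ∨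
        ((a δ).faces.1 ∉ meshFaces (fun (_ : ℤ) => θ) D.carrier δ ∧
          (a δ).faces.2 ∈ meshFaces (fun (_ : ℤ) => θ) D.carrier δ)) ∧
      (((b δ).faces.1 ∈ meshFaces (fun (_ : ℤ) => θ) D.carrier δ ∧
          (b δ).faces.2 ∉ meshFaces (fun (_ : ℤ) => θ) D.carrier δ) ∨
        ((b δ).faces.1 ∉ meshFaces (fun (_ : ℤ) => θ) D.carrier δ ∧
          (b δ).faces.2 ∈ meshFaces (fun (_ : ℤ) => θ) D.carrier δ)) := by
  classical
  -- interior points `z i n → D.pt i`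
  have hz : ∀ (i : Fin 2) (n : ℕ), ∃ z ∈ D.carrier, dist z (D.pt i) < 1 / ((n : ℝ) + 1) := by
    intro i n
    obtain ⟨z, hz, hd⟩ := Metric.mem_closure_iff.1
      (frontier_subset_closure (D.pt_mem_frontier i)) (1 / ((n : ℝ) + 1)) (by positivity)
    exact ⟨z, hz, by rwa [dist_comm]⟩
  choose z hzΩ hzd using hz
  have hpt : ∀ i : Fin 2, D.pt i ∉ D.carrier := fun i h => by
    have hf := D.pt_mem_frontier i
    rw [frontier, D.isOpen.interior_eq] at hf
    exact hf.2 h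
  have hst := fun n => exists_bdry_threshold hθ D (hzΩ 0 n) (hzΩ 1 n) (hpt 0) (hpt 1)
  choose ε hε hgood using hst
  choose a b hab using hgood
  obtain ⟨N, hN, hNtop⟩ := exists_stage_tendsto_atTop (p := fun n δ => 0 < δ ∧ δ < ε n)
    (ε := ε) hε (fun n δ h₁ h₂ => ⟨h₁, h₂⟩)
  have hgoodN := hN.mono fun δ hδ => hab (N δ) δ hδ.1 hδ.2
  refine ⟨fun δ => a (N δ) δ, fun δ => b (N δ) δ, ⟨?_, ?_, ?_⟩, ?_⟩
  · exact hgoodN.mono fun δ h => h.2.2.1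
  · exact tendsto_of_eventually_dist_le (hgoodN.mono fun δ h => h.2.2.2.1) (hzd 0) hNtop
  · exact tendsto_of_eventually_dist_le (hgoodN.mono fun δ h => h.2.2.2.2) (hzd 1) hNtop
  · exact hgoodN.mono fun δ h => ⟨h.1, h.2.1⟩

end ThirdEndpoints

open ThirdEndpoints in
/-- **Boundary endpoint approximations at every constant angle `θ ∈ [π/3, 2π/3]`** (the
all-angle form of the stub below, boundary clause included). [folklore] -/
theorem ybBdryEndpoints_of_mem_Icc : ∀ θ ∈ Set.Icc (Real.pi / 3) (2 * Real.pi / 3), ∀ D : DobrushinDomain, ∃ a b : ℝ → MidEdge, IsYBEndpointApprox (fun (_ : ℤ) => θ) D a b ∧ ∀ᶠ δ in 𝓝[>] (0 : ℝ), (((a δ).faces.1 ∈ meshFaces (fun (_ : ℤ) => θ) D.carrier δ ∧ (a δ).faces.2 ∉ meshFaces (fun (_ : ℤ) => θ) D.carrier δ) ∨ ((a δ).faces.1 ∉ meshFaces (fun (_ : ℤ) => θ) D.carrier δ ∧ (a δ).faces.2 ∈ meshFaces (fun (_ : ℤ) => θ) D.carrier δ)) ∧ (((b δ).faces.1 ∈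 meshFaces (fun (_ : ℤ) => θ) D.carrier δ ∧ (b δ).faces.2 ∉ meshFaces (fun (_ : ℤ) => θ) D.carrier δ) ∨ ((b δ).faces.1 ∉ meshFaces (fun (_ : ℤ) => θ) D.carrier δ ∧ (b δ).faces.2 ∈ meshFaces (fun (_ : ℤ) => θ) D.carrier δ)) :=
  fun _ hθ D => ybBdryEndpoints hθ D

open ThirdEndpoints in
/-- **Endpoint approximations exist on every constant-angle Glazman–Manolescu tiling
`θ ∈ [π/3, 2π/3]`** — verbatim conjunct (i) of route SAWTrackTransport's `YBLimitExists`
(stmt-CriticalPhenomena-16995): the hypothesis `IsYBEndpointApprox (fun _ => α) D a b` of the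
Yang–Baxter convergence statements is never vacuous. [folklore] -/
theorem ybEndpoints_of_mem_Icc : ∀ α ∈ Set.Icc (Real.pi / 3) (2 * Real.pi / 3), ∀ D : DobrushinDomain, ∃ a b : ℝ → MidEdge, IsYBEndpointApprox (fun (_ : ℤ) => α) D a b := by
  intro α hα D
  obtain ⟨a, b, h, -⟩ := ybBdryEndpoints hα D
  exact ⟨a, b, h⟩

open ThirdEndpoints in
/-- **Stub `stub_thirdBdryEndpoints`** (line `yb-relay`, crux `HexTransfer`,
stmt-CriticalPhenomena-14221; `ThirdBdryEndpoints` unfolded): every Dobrushin domain admits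
mid-edge endpoint approximations on Glazman–Manolescu's hexagonal point `Θ ≡ π/3` THROUGH
BOUNDARY EDGES of `Ω_δ = meshFaces (π/3) Ω δ` — for all small `δ > 0` exactly one of the two
faces of `a_δ` (resp. `b_δ`) lies in `Ω_δ`, a Yang–Baxter walk of `Ω_δ` joins `a_δ` to `b_δ`, and
`δ a_δ → a`, `δ b_δ → b`. The case `θ = π/3` of `ybBdryEndpoints`. [folklore] -/
theorem stub_thirdBdryEndpoints : ∀ D : DobrushinDomain, ∃ a b : ℝ → MidEdge, IsYBEndpointApprox (fun (_ : ℤ) => Real.pi / 3) D a b ∧ ∀ᶠ δ in 𝓝[>] (0 : ℝ), (((a δ).faces.1 ∈ meshFaces (fun (_ : ℤ) => Real.pi / 3) D.carrier δ ∧ (a δ).faces.2 ∉ meshFaces (fun (_ : ℤ) => Real.pi / 3) D.carrier δ) ∨ ((a δ).faces.1 ∉ meshFaces (fun (_ : ℤ) => Real.pi / 3) D.carrier δ ∧ (a δ).faces.2 ∈ meshFaces (fun (_ : ℤ) => Real.pi / 3) D.carrier δ)) ∧ (((b δ).faces.1 ∈ meshFaces (fun (_ : ℤ) => Real.pi / 3)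 D.carrier δ ∧ (b δ).faces.2 ∉ meshFaces (fun (_ : ℤ) => Real.pi / 3) D.carrier δ) ∨ ((b δ).faces.1 ∉ meshFaces (fun (_ : ℤ) => Real.pi / 3) D.carrier δ ∧ (b δ).faces.2 ∈ meshFaces (fun (_ : ℤ) => Real.pi / 3) D.carrier δ)) := by
  intro D
  exact ybBdryEndpoints (θ := Real.pi / 3) ⟨le_rfl, by linarith [Real.pi_pos]⟩ D

end Summit.CriticalPhenomena.SAWScalingLimit.Cruxes.HexTransfer.YbRelay
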